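import Mathlib
import Summits.Ventures.PercRepro.PuncturedLYMUnif33Table
import Summits.Ventures.PercRepro.PuncturedLYMUnif33Cols1

/-!
# PercRepro — (SP) FOR ANY NUMBER OF PAIRWISE DISJOINT `3`-SETS AT LEVEL `3`: THE COLUMN IDENTITIES, ASSEMBLED
(p10, gen 40)

`col_check`: the column identity of every free column class with `Σ v d_v ≤ 4`, by `interval_cases` over the class counts.  Nothing here asserts (SP).
-/

namespace PercRepro.PuncturedLYM.Split.TypeLift.Unif33

/-- The column identity of every free column class, in one statement. -/
theorem col_check (n k : ℚ) (hQ : Qp n k ≠ 0) (hP : Pp n k ≠ 0) (d1 d2 : ℕ)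
    (h : d1 + 2 * d2 ≤ 4) :
    1 * (d1 : ℚ) * raw n k (d1 - 1) d2 0 + 2 * (d2 : ℚ) * raw n k (d1 + 1) (d2 - 1) 1 +
      ((4 : ℚ) - d1 - 2 * d2) * raw n k d1 d2 3 = 1 := by
  have hb1 : d1 ≤ 4 := by omega
  have hb2 : d2 ≤ 2 := by omega
  interval_cases d1 <;> interval_cases d2 <;> push_cast
  · linear_combination col_00 n k hQ hP
  · linear_combination col_01 n k hQ hP
  · linear_combination col_02 n k hQ hP
  · linear_combination col_10 n k hQ hP
  · linear_combination col_11 n k hQ hP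
  · omega
  · linear_combination col_20 n k hQ hP
  · linear_combination col_21 n k hQ hP
  · omega
  · linear_combination col_30 n k hQ hP
  · omega
  · omega
  · linear_combination col_40 n k hQ hP
  · omega
  · omega

end PercRepro.PuncturedLYM.Split.TypeLift.Unif33
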